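import Summits.Ventures.PercRepro.RankLevelSetHallLostInjLevel
import Summits.Ventures.PercRepro.RankLevelSetHallLostMember

/-!
# PercRepro — THE SOURCES AT A CYCLIC SET WITH TWO DISJOINT BASES ARE THE BI-INDEPENDENT SETS (p4, gen 35; C-044,
UP form at the tight layer; paper proofs/P4-CELL-THREE.md §14.22 (n)–(o))

Fix `C ⊆ E` with `F = cl C`, `ρ = r(C)`, and `K ⊆ E ∖ F` independent over `F` (`r(C ∪ K) = ρ + #K`), `r(C ∪ K) = q`,
`q < #(C ∪ K) < p`.  When `#F = 2ρ` and some basis `Z₀ ⊆ C` of `C` has `F ∖ Z₀` independent (two disjoint bases of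
`F`, one inside `C`), the lost-set condition on `C ∪ K` — the existence of a member inside it — is EXACTLY the
independence over `F` of the complement `A = (E ∖ F) ∖ K`: `r(C ∪ A) = ρ + #A`.  So at such a cyclic set the sources
of the per-cyclic-set injection (`lostInj_of_cyclicInj`) are the `K` with both `K` and `(E ∖ F) ∖ K` independent over
`F` — the bottom level of the bi-independent poset of the contraction — and the per-cyclic-set Hall condition is the
statement (DB) of §14.22 (n).
* `notMem_closure_sdiff_of_indep_over` — the elements of `K` are coloops of `C ∪ K`;
* **`mem_lostSets_iff_of_closure_twoBases`** — the characterisation.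
Axioms: standard.
-/

namespace PercRepro

open Set Matroid

variable {α : Type} (M : Matroid α) [M.Finite]

omit [M.Finite] in
/-- If `K` is independent over `C` (`r(C ∪ K) = r C + #K`, `K` finite), every `x ∈ K` is a coloop of `C ∪ K`. -/
theorem notMem_closure_sdiff_of_indep_over {C K : Set α} (hKfin : K.Finite)
    (hCK : M.eRk (C ∪ K) = M.eRk C + K.encard) (hCtop : M.eRk C ≠ ⊤) {x : α} (hxK : x ∈ K) :
    x ∉ M.closure ((C ∪ K) \ {x}) := by
  intro hx
  have h1 : M.eRk ((C ∪ K) \ {x}) = M.eRk (C ∪ K) :=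
    eRk_sdiff_singleton_eq_of_mem_closure M (Or.inr hxK) hx
  have h2 : M.eRk ((C ∪ K) \ {x}) ≤ M.eRk (C ∪ (K \ {x})) := by
    refine M.eRk_mono ?_
    intro y hy
    rcases hy.1 with hyC | hyK
    · exact Or.inl hyC
    · exact Or.inr ⟨hyK, hy.2⟩
  have h3 : M.eRk (C ∪ (K \ {x})) ≤ M.eRk C + (K \ {x}).encard := M.eRk_union_le_eRk_add_encard _ _
  have h4 : (K \ {x}).encard + 1 = K.encard := encard_sdiff_singleton_add_one hxK
  obtain ⟨c, hc⟩ : ∃ c : ℕ, M.eRk C = c := ⟨_, (ENat.coe_toNat hCtop).symm⟩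
  have hKx : (K \ {x}).Finite := hKfin.subset sdiff_subset
  rw [← hKx.cast_ncard_eq] at h3 h4
  rw [← hKfin.cast_ncard_eq] at h4 hCK
  rw [h1, hCK, hc] at h2
  rw [hc] at h3
  have h5 := h2.trans h3
  rw [← Nat.cast_add, ← Nat.cast_add] at h5
  have h6 : c + K.ncard ≤ c + (K \ {x}).ncard := by exact_mod_cast h5
  rw [← Nat.cast_one, ← Nat.cast_add] at h4
  have h7 : (K \ {x}).ncard + 1 = K.ncard := by exact_mod_cast h4
  omega

/-- **At a cyclic set whose closure has two disjoint bases, one inside `C`, the lost sets `C ∪ K` are exactly those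
whose complement `(E ∖ cl C) ∖ K` is independent over `cl C`.**  Hypotheses: `#cl C = 2 r(C)`; a basis `Z₀ ⊆ C` of
`C` with `cl C ∖ Z₀` independent; `K ⊆ E ∖ cl C` independent over `C` with `r(C ∪ K) = q` and `q < #(C ∪ K) < p`;
`#E = p + q`. -/
theorem mem_lostSets_iff_of_closure_twoBases {p q : ℕ} (hE : M.E.ncard = p + q) {C K : Set α} (hCE : C ⊆ M.E)
    (hF : (M.closure C).encard = 2 * M.eRk C)
    (hZC : ∃ Z₀ ⊆ C, M.Indep Z₀ ∧ M.eRk Z₀ = M.eRk C ∧ M.Indep (M.closure C \ Z₀))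
    (hK : K ⊆ M.E \ M.closure C) (hCK : M.eRk (C ∪ K) = M.eRk C + K.encard) (hq : M.eRk (C ∪ K) = (q : ℕ∞))
    (hlt : q < (C ∪ K).ncard) (hlt' : (C ∪ K).ncard < p) :
    C ∪ K ∈ lostSets M p q ↔
      M.eRk (C ∪ ((M.E \ M.closure C) \ K)) = M.eRk C + ((M.E \ M.closure C) \ K).encard := by
  classical
  set F := M.closure C with hFdef
  set A := (M.E \ F) \ K with hAdef
  have hEfin : M.E.Finite := M.ground_finite
  have hFE : F ⊆ M.E := M.closure_subset_ground C
  have hCF : C ⊆ F := M.subset_closure C hCE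
  have hKE : K ⊆ M.E := fun x hx => (hK hx).1
  have hKF : ∀ x ∈ K, x ∉ F := fun x hx => (hK hx).2
  have hKfin : K.Finite := hEfin.subset hKE
  have hCfin : C.Finite := hEfin.subset hCE
  have hFfin : F.Finite := hEfin.subset hFE
  have hAfin : A.Finite := hEfin.subset (sdiff_subset.trans sdiff_subset)
  have hCtop : M.eRk C ≠ ⊤ := ((M.eRk_le_encard C).trans_lt hCfin.encard_lt_top).ne
  obtain ⟨ρ, hρ⟩ : ∃ ρ : ℕ, M.eRk C = ρ := ⟨_, (ENat.coe_toNat hCtop).symm⟩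
  have hFrk : M.eRk F = ρ := by rw [hFdef, M.eRk_closure_eq, hρ]
  have hAF : Disjoint A F := disjoint_left.2 (fun y hy => hy.1.2)
  have hAK : Disjoint A K := disjoint_left.2 (fun y hy => hy.2)
  have hSE : C ∪ K ⊆ M.E := union_subset hCE hKE
  -- a basis of `F` spans `C`: `r(X ∪ G) = r(X ∪ C)` for every `X`
  have key : ∀ G : Set α, G ⊆ F → M.Indep G → (ρ : ℕ∞) ≤ G.encard →
      ∀ X : Set α, M.eRk (X ∪ G) = M.eRk (X ∪ C) := by
    intro G hGF hGind hGcard X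
    have hGfin : G.Finite := hFfin.subset hGF
    have hB : M.IsBasis G F := hGind.isBasis_of_eRk_ge hGfin hGF (by rw [hFrk, hGind.eRk_eq_encard]; exact hGcard)
    have hcl : M.closure G = M.closure C := by rw [hB.closure_eq_closure, hFdef, M.closure_closure]
    rw [← M.eRk_union_closure_right_eq X G, hcl, M.eRk_union_closure_right_eq]
  constructor
  · -- a member inside `C ∪ K` forces `A` independent over `F`
    rintro ⟨-, hSq, -, -, Z, hZ, hZS⟩
    have hZind : M.Indep Z := indep_of_mem_cellMembers M hE hZ
    have hZc : M.Indep (M.E \ Z) := (compl_indep_of_mem_U M hE hZ).1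
    have hKZ : K ⊆ Z := by
      intro x hx
      refine mem_of_eRk_eq_of_notMem_closure M hSE hZS (by rw [hZ.2.1, hSq]) (by rw [hSq]; exact ENat.coe_ne_top q)
        (Or.inr hx) (notMem_closure_sdiff_of_indep_over M hKfin hCK hCtop hx)
    set G := F \ Z with hGdef
    have hGF : G ⊆ F := sdiff_subset
    have hGind : M.Indep G := hZc.subset (sdiff_subset_sdiff_left hFE)
    -- `Z ∩ F ⊆ C`, so `#(F ∩ Z) ≤ ρ`
    have hFZC : F ∩ Z ⊆ C := by
      intro y hy
      rcases hZS hy.2 with hyC | hyK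
      · exact hyC
      · exact absurd hy.1 (hKF y hyK)
    have h1 : (F ∩ Z).encard ≤ M.eRk C :=
      (hZind.subset inter_subset_right).encard_le_eRk_of_subset hFZC
    have h2 : F.encard = (F ∩ Z).encard + G.encard := by
      rw [← encard_union_eq disjoint_sdiff_inter.symm, inter_union_sdiff]
    have hGcard : (ρ : ℕ∞) ≤ G.encard := by
      have h3 : F.encard ≤ M.eRk C + G.encard := by
        rw [h2]; exact add_le_add h1 le_rfl
      rw [hF, hρ] at h3
      have hGfin : G.Finite := hFfin.subset hGF
      rw [← hGfin.cast_ncard_eq] at h3 ⊢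
      have h4 : 2 * ρ ≤ ρ + G.ncard := by exact_mod_cast h3
      exact_mod_cast (by omega : ρ ≤ G.ncard)
    -- `A ∪ G ⊆ E ∖ Z` is independent
    have hAZ : A ⊆ M.E \ Z := by
      intro y hy
      refine ⟨hy.1.1, fun hyZ => ?_⟩
      rcases hZS hyZ with hyC | hyK
      · exact hy.1.2 (hCF hyC)
      · exact hy.2 hyK
    have hGZ : G ⊆ M.E \ Z := fun y hy => ⟨hFE hy.1, hy.2⟩
    have hAGind : M.Indep (A ∪ G) := hZc.subset (union_subset hAZ hGZ)
    have hAG : Disjoint A G := hAF.mono_right hGF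
    have h5 : M.eRk (A ∪ G) = A.encard + G.encard := by rw [hAGind.eRk_eq_encard, encard_union_eq hAG]
    have hGeq : G.encard = ρ := by
      refine le_antisymm ?_ hGcard
      rw [← hFrk]; exact hGind.encard_le_eRk_of_subset hGF
    rw [key G hGF hGind hGcard A, hGeq, ← hρ, union_comm] at h5
    rw [h5, add_comm]
  · -- `A` independent over `F` gives the member `Z₀ ∪ K`
    intro hA
    obtain ⟨Z₀, hZ₀C, hZ₀ind, hZ₀rk, hGind⟩ := hZC
    set G := F \ Z₀ with hGdef
    have hZ₀F : Z₀ ⊆ F := hZ₀C.trans hCF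
    have hZ₀card : Z₀.encard = ρ := by rw [← hZ₀ind.eRk_eq_encard, hZ₀rk, hρ]
    have hGcard : G.encard = ρ := by
      have h2 : F.encard = Z₀.encard + G.encard := by
        rw [← encard_union_eq disjoint_sdiff_right, union_sdiff_cancel hZ₀F]
      have hGfin : G.Finite := hFfin.subset sdiff_subset
      have hZ₀fin : Z₀.Finite := hFfin.subset hZ₀F
      rw [hF, hρ, hZ₀card, ← hGfin.cast_ncard_eq] at h2
      rw [← hGfin.cast_ncard_eq]
      have h3 : 2 * ρ = ρ + G.ncard := by exact_mod_cast h2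
      exact_mod_cast (by omega : G.ncard = ρ)
    have hZ₀cl : M.closure Z₀ = M.closure C := by
      have hB : M.IsBasis Z₀ C :=
        hZ₀ind.isBasis_of_eRk_ge (hCfin.subset hZ₀C) hZ₀C (by rw [hZ₀rk])
      exact hB.closure_eq_closure
    -- the member
    set Z := Z₀ ∪ K with hZdef
    have hZE : Z ⊆ M.E := union_subset (hZ₀F.trans hFE) hKE
    have hZrk : M.eRk Z = (q : ℕ∞) := by
      rw [hZdef, ← M.eRk_union_closure_left_eq, hZ₀cl, M.eRk_union_closure_left_eq, hq]
    have hEZ : M.E \ Z = A ∪ G := by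
      ext y
      constructor
      · rintro ⟨hyE, hyZ⟩
        by_cases hyF : y ∈ F
        · exact Or.inr ⟨hyF, fun h => hyZ (Or.inl h)⟩
        · exact Or.inl ⟨⟨hyE, hyF⟩, fun h => hyZ (Or.inr h)⟩
      · rintro (hy | hy)
        · refine ⟨hy.1.1, ?_⟩
          rintro (h | h)
          · exact hy.1.2 (hZ₀F h)
          · exact hy.2 h
        · refine ⟨hFE hy.1, ?_⟩
          rintro (h | h)
          · exact hy.2 h
          · exact hKF y h hy.1
    have hAG : Disjoint A G := hAF.mono_right sdiff_subset
    have hEZrk : M.eRk (M.E \ Z) = (M.E \ Z).encard := by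
      rw [hEZ, key G sdiff_subset hGind (by rw [hGcard]) A, union_comm, hA, encard_union_eq hAG, hGcard, hρ,
        add_comm]
    have hZcard : Z.encard = (q : ℕ∞) := by
      have hZ₀K : Disjoint Z₀ K := disjoint_left.2 (fun y hy hyK => hKF y hyK (hZ₀F hy))
      rw [hZdef, encard_union_eq hZ₀K, hZ₀card]
      have h1 : (ρ : ℕ∞) + K.encard = (q : ℕ∞) := by rw [← hρ, ← hCK, hq]
      exact h1
    have hEZcard : (M.E \ Z).encard = (p : ℕ∞) := by
      have h1 : (M.E \ Z).encard + Z.encard = M.E.encard := encard_sdiff_add_encard_of_subset hZE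
      rw [hZcard, ← hEfin.cast_ncard_eq, hE] at h1
      have hEZfin : (M.E \ Z).Finite := hEfin.subset sdiff_subset
      rw [← hEZfin.cast_ncard_eq] at h1 ⊢
      have h2 : (M.E \ Z).ncard + q = p + q := by exact_mod_cast h1
      exact_mod_cast (by omega : (M.E \ Z).ncard = p)
    have hZmem : Z ∈ cellMembers M p q := ⟨hZE, hZrk, by rw [hEZrk, hEZcard]⟩
    exact ⟨hSE, hq, hlt, hlt', Z, hZmem, union_subset_union hZ₀C (subset_refl K)⟩

end PercRepro
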